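import Mathlib
import HarnessLib
import Summits.NavierStokesRegularity.NavierStokesRegularity.Theorems.PoloidalWindowRigidity.Negative.GaugeClauseDrift
import Summits.NavierStokesRegularity.NavierStokesRegularity.Theorems.PoloidalWindowRigidity.Negative.DriftProfileNoPeriod

/-!
# Crux `PoloidalWindowRigidity` (K2, stmt-NavierStokesRegularity-19708) — negative side:
# the rev-8 residue S2″ (`stub_residueAperiodicCriticalStrain`) without the Oseen-mild clause is FALSE

Negative-side support (refuter seat ns-regularity-refuter1, cell ns-regularity-ideate; D-0081 §C). By-name K-read
certificate for skeleton rev 8 of the line `slicesharp-screw` (nsreg-p7, sha16 ae4a88697fe0be6e): its one open stub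
S2″ = S2′ + two clauses,

* (VP) no vertical period: `∀ L > 0, ∃ s < 0, ∃ y, v s (y + L e₂) ≠ v s y`;
* (CS) critical horizontal strain somewhere: `∀ Λ < 1, ∃ s < 0, ∃ y a, a ⊥ e₂ ∧ Λ‖a‖² < (−s)⟪Dv(s,y)a, a⟫`.

The drifting cellular witness `w` of `…Negative.DriftProfile` satisfies both: (VP) by `driftProfile_no_common_period`
(no non-zero common period at all), (CS) at `s = −1`, `y = (π/2, 0, π)`, `a = e₀`, where `(−s)⟪Dw a, a⟫ = ∂₀w₀ =
−cos π · sin(π/2) = 1`. Hence `residueAperiodicCriticalStrain_false_with_classRates_without_mild`: S2″ with the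
Oseen-mild identity replaced by the two `ClassRate` bounds (and the uncertified any-frame axisymmetry clause deleted, as
in N4/N7) is FALSE — the negative lane N1–N9 survives rev 8 unchanged; (M) remains the single load-bearing hypothesis.
[folklore]
-/

noncomputable section

namespace Summit.NavierStokesRegularity.NavierStokesRegularity.Theorems.PoloidalWindowRigidity.Negative

open Set Function
open scoped RealInnerProductSpace InnerProductSpace Laplacian
open Literature.Analysis Literature.Analysis.FluidPDE

/-- (VP) The drifting profile has no vertical period: for every `L > 0` some slice is moved by `y ↦ y + L e₂`.
[folklore] -/
theorem driftProfile_no_vertical_period (L : ℝ) (hL : 0 < L) :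
    ∃ s < 0, ∃ y : EuclideanSpace ℝ (Fin 3),
      driftProfile s (y + L • EuclideanSpace.single 2 (1 : ℝ)) ≠ driftProfile s y := by
  refine driftProfile_no_common_period _ (smul_ne_zero hL.ne' ?_)
  intro h
  have h2 := congrArg (fun v : EuclideanSpace ℝ (Fin 3) => v 2) h
  simp at h2

/-- (CS) The drifting profile attains the critical horizontal strain: at `s = −1`, `y = (π/2, 0, π)`, `a = e₀` one has
`(−s)⟪Dw(s,y)a, a⟫ = 1 > Λ` for every `Λ < 1`. [folklore] -/
theorem driftProfile_critical_strain (Λ : ℝ) (hΛ : Λ < 1) :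
    ∃ s < 0, ∃ (y a : EuclideanSpace ℝ (Fin 3)), ⟪a, EuclideanSpace.single 2 (1 : ℝ)⟫_ℝ = 0 ∧
      Λ * ‖a‖ ^ 2 < (-s) * ⟪fderiv ℝ (driftProfile s) y a, a⟫_ℝ := by
  refine ⟨-1, by norm_num,
    (Real.pi / 2) • EuclideanSpace.single 0 (1 : ℝ) + Real.pi • EuclideanSpace.single 2 (1 : ℝ),
    EuclideanSpace.single 0 (1 : ℝ), ?_, ?_⟩
  · rw [EuclideanSpace.inner_single_right]; simp
  · have hval : ⟪fderiv ℝ (driftProfile (-1))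
        ((Real.pi / 2) • EuclideanSpace.single 0 (1 : ℝ) + Real.pi • EuclideanSpace.single 2 (1 : ℝ))
        (EuclideanSpace.single 0 (1 : ℝ)), EuclideanSpace.single 0 (1 : ℝ)⟫_ℝ = 1 := by
      rw [EuclideanSpace.inner_single_right]
      simp [fderiv_driftProfile_apply, cellDeriv_apply_zero, driftShift_neg_one, cellAmp]
    rw [hval]
    simpa using hΛ

/-- **S2″ without the Oseen-mild clause is FALSE** (K-read certificate for skeleton rev 8): the hypothesis list of
`stub_residueAperiodicCriticalStrain` verbatim — Type-I rate, joint continuity, divergence-free, poloidal and frozen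
vorticity, vorticity direction non-constant, not vertically rigid, flat in no horizontal direction, translation-invariant
along no line, not scale-invariant about the apex, screw-invariant about no vertical axis, the no-source-gauge clause,
(VP) and (CS) — with the Oseen-mild identity REPLACED by the two `ClassRate` slice bounds `‖Dv‖ ≤ C₁/(−t)`,
`‖curl v‖ ≤ C₂/(−t)` and the any-frame axisymmetry clause deleted, does NOT exclude a backward singularity at the apex:
the drifting cellular profile satisfies everything (`C = 4, C₁ = 8, C₂ = 4`) and is backward-singular. [folklore] -/
theorem residueAperiodicCriticalStrain_false_with_classRates_without_mild :
    ¬ (∀ (C C₁ C₂ : ℝ) (v : ℝ → EuclideanSpace ℝ (Fin 3) → EuclideanSpace ℝ (Fin 3)),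
      Literature.Analysis.FluidPDE.HasTypeITimeDecay C v →
      ContinuousOn (Function.uncurry v) (Set.Iio (0 : ℝ) ×ˢ Set.univ) →
      (∀ t < 0, ∀ y, ‖fderiv ℝ (v t) y‖ ≤ C₁ / (-t)) →
      (∀ t < 0, ∀ y, ‖Literature.Analysis.FluidPDE.curl (v t) y‖ ≤ C₂ / (-t)) →
      (∀ t < 0, Literature.Analysis.FluidPDE.VectorCalculus.IsDivFree (v t)) →
      (∀ s < 0, ∀ y, ⟪Literature.Analysis.FluidPDE.curl (v s) y, EuclideanSpace.single 2 1⟫_ℝ = 0) →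
      (∀ s < 0, ∀ y, ⟪fderiv ℝ (v s) y (Literature.Analysis.FluidPDE.curl (v s) y), EuclideanSpace.single 2 1⟫_ℝ = 0) →
      (∀ s < 0, ∀ b : EuclideanSpace ℝ (Fin 3), b ≠ 0 → ∃ y,
        Literature.Analysis.FluidPDE.cross (Literature.Analysis.FluidPDE.curl (v s) y) b ≠ 0) →
      (∀ s < 0, ∃ y, fderiv ℝ (v s) y (EuclideanSpace.single 2 1) 0 ≠ 0 ∨
        fderiv ℝ (v s) y (EuclideanSpace.single 2 1) 1 ≠ 0) →
      (∀ s < 0, ∀ a : EuclideanSpace ℝ (Fin 3), a ≠ 0 → ⟪a, EuclideanSpace.single 2 1⟫_ℝ = 0 →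
        ∃ y, ⟪fderiv ℝ (v s) y a, EuclideanSpace.single 2 1⟫_ℝ ≠ 0) →
      (∀ s < 0, ∀ e : EuclideanSpace ℝ (Fin 3), e ≠ 0 → ∃ (y : EuclideanSpace ℝ (Fin 3)) (l : ℝ), v s (y + l • e) ≠ v s y) →
      (∃ lam : ℝ, 0 < lam ∧ ∃ s < 0, ∃ y, lam • v (lam ^ 2 * s) (lam • y) ≠ v s y) →
      (∀ κ : ℝ, κ ≠ 0 → ∀ c : EuclideanSpace ℝ (Fin 3), ∃ s < 0, ∃ (a : ℝ) (y : EuclideanSpace ℝ (Fin 3)),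
        v s (c + Literature.Analysis.FluidPDE.rotZ (κ * a) (y - c) + a • EuclideanSpace.single 2 (1 : ℝ)) ≠
          Literature.Analysis.FluidPDE.rotZ (κ * a) (v s y)) →
      (∀ (ψ : ℝ → EuclideanSpace ℝ (Fin 3) → ℝ) (src : ℝ → ℝ) (x₀ : EuclideanSpace ℝ (Fin 3)) (ε : ℝ → ℝ),
        ContDiffOn ℝ 2 (Function.uncurry ψ) (Set.Iio (0 : ℝ) ×ˢ Set.univ) →
        (∀ t < 0, ∀ y, Literature.Analysis.FluidPDE.curl (v t) y 0 = fderiv ℝ (ψ t) y (EuclideanSpace.single 1 1) ∧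
          Literature.Analysis.FluidPDE.curl (v t) y 1 = -fderiv ℝ (ψ t) y (EuclideanSpace.single 0 1)) →
        (∀ t < 0, ∀ x, |ψ t x - ψ t x₀| ≤ ε t * ‖x - x₀‖) →
        ContinuousOn ε (Set.Iio 0) →
        Filter.Tendsto (fun t => ε t * Real.sqrt (-t)) Filter.atBot (nhds 0) →
        ∃ t < 0, ∃ x, deriv (fun τ => ψ τ x) t + fderiv ℝ (ψ t) x (v t x) - (Δ (ψ t)) x ≠ src t) →
      (∀ L : ℝ, 0 < L → ∃ s < 0, ∃ y, v s (y + L • EuclideanSpace.single 2 (1 : ℝ)) ≠ v s y) →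
      (∀ Λ : ℝ, Λ < 1 → ∃ s < 0, ∃ (y a : EuclideanSpace ℝ (Fin 3)), ⟪a, EuclideanSpace.single 2 (1 : ℝ)⟫_ℝ = 0 ∧
        Λ * ‖a‖ ^ 2 < (-s) * ⟪fderiv ℝ (v s) y a, a⟫_ℝ) →
      ¬ Literature.Analysis.FluidPDE.IsBackwardSingularPoint v 0) := by
  intro h
  refine h 4 8 4 driftProfile hasTypeITimeDecay_driftProfile continuousOn_driftProfile
    (fun t ht y => norm_fderiv_driftProfile_le ht y) (fun t ht y => norm_curl_driftProfile_le ht y)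
    (fun t _ => isDivFree_driftProfile t) (fun s _ y => poloidal_driftProfile s y)
    (fun s _ y => frozen_driftProfile s y)
    (fun s hs b hb => vorticityDirection_nonconstant_driftProfile hs b hb)
    (fun s hs => (not_vertRigid_driftProfile hs).imp fun _ h => Or.inl h)
    (fun s hs a ha ha2 => flat_in_no_horizontal_direction_driftProfile hs a ha ha2)
    (fun s hs e he => not_translationInvariant_driftProfile hs e he)
    ⟨2, two_pos, -1, by norm_num, 0, not_scaleInvariant_driftProfile⟩
    (fun κ _ c => ⟨-1, by norm_num, Real.pi / 2, not_screwInvariant_driftProfile (κ * (Real.pi / 2)) c⟩)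
    (fun ψ src _ _ hψ hstr _ _ _ => noSourceGauge_driftProfile ψ src hψ hstr)
    (fun L hL => driftProfile_no_vertical_period L hL)
    (fun Λ hΛ => driftProfile_critical_strain Λ hΛ)
    isBackwardSingularPoint_driftProfile

end Summit.NavierStokesRegularity.NavierStokesRegularity.Theorems.PoloidalWindowRigidity.Negative

end
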